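import Literature.IUT.LogVolume.LatticeAutBalls
import Literature.Barriers.ABC.IUTDisputedClaim
import HarnessLib

/-!
# MJ-HARVEST partition inv-2 — candidate Props (typed ≠ proved; author-labelled claims; NO side on [IUTchIII] Cor. 3.12;
# abc / Szpiro NOT proved). Seat abc-iut-inv-2 (planner, D-0156 point 3), critic abc-iut-crit-A.

Every `def … : Prop` below is a CANDIDATE typing of a sentence CLAIMED in one of the four partition documents
(Mochizuki: *Formalization of IUT* slides 2026-04; *IUT as an Anabelian Gateway* 2025; *Teichmüller dilations of varying hues*
ICMS 2025; *On the essential logical structure of IUT* [EssLgc] v. 2024), typed over EXISTING tree declarations, against the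
barrier `Literature.Barriers.ABC.IUTDisputedClaim` (because-clause: [ScholzeStix2018 §2.2 p.10] «consistent identification of
copies of ℝ forces omitting the scalars j²» / «blurring by a factor of at least O(ℓ²)»). Nothing is asserted; the two `theorem`s are
elementary sanity proofs of the typed (NoRng) sentence and of a monotonicity, included so the critic can see the rows are not vacuous.
-/

noncomputable section

open Set Metric
open scoped Pointwise

namespace Summit.ABC.ABC.Cruxes.ThetaPartII.MJHarvest2

/-- Pointer only: the barrier conjecture the harvest is typed against (unchanged, not asserted). -/
example : Prop := Literature.Barriers.ABC.IUTDisputedClaim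

section LatticeAut

variable (p : ℕ) [Fact p.Prime] (K : Type*) [NontriviallyNormedField K] [NormedAlgebra ℚ_[p] K] [IsUltrametricDist K]

/-- **ROW A1 — [EssLgc] Example 3.5.1 (iii), p. 102 (Mochizuki): «there exists a positive integer t that depends only on the
isomorphism class of the field k such that for any automorphism φ of the ℤ_p-module 𝓘_k and any nonzero q ∈ 𝒪_k, the absolute value
of the difference between the orders of q and φ(q) is ≤ t».** CONCRETE typing at the tree's p-adic model: for ANY additive subgroup
`Λ ⊆ K` sandwiched `closedBall 0 1 ⊆ Λ ⊆ closedBall 0 R` (the log-shell `𝓘_k ⊇ 𝒪_k` is such, tree `closedBall_subset_logShell`) and any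
`ℚ_p`-linear automorphism `φ` stabilising `Λ` (tree `Literature.IUT.LogVolume.latticeAut`, the cell's (Ind2) shape), `‖φ x‖ ≤ p·R·‖x‖`
— i.e. `t = 1 + log_p R` in `p`-adic orders, INDEPENDENT of `ℓ`. (Proof route, not carried out: rescale `x` by `p^n` into the annulus
`p⁻¹ < ‖p^n x‖ ≤ 1 ⊆ Λ`, apply `φ(Λ) = Λ ⊆ closedBall 0 R`.) -/
def LatticeAutBoundedDiscrepancy (R : ℝ) : Prop :=
  ∀ Λ : AddSubgroup K, closedBall (0 : K) 1 ⊆ (Λ : Set K) → (Λ : Set K) ⊆ closedBall (0 : K) R →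
    ∀ φ : K ≃ₗ[ℚ_[p]] K, φ ∈ Literature.IUT.LogVolume.latticeAut ℚ_[p] Λ.toIntSubmodule →
      ∀ x : K, ‖φ x‖ ≤ p * R * ‖x‖

/-- **ROW A2 — [EssLgc] Example 3.5.1 (ii), p. 102 (Mochizuki): «φ(U(𝒪_k, n)) ⊆ ⋃_{i=−s}^{s} U(𝒪_k, n+i)» (shells moved by at most
`s` steps).** Shell/ball form of A1: a lattice automorphism maps every ball `closedBall 0 r` into `closedBall 0 (p·R·r)`. -/
def LatticeAutShellDisplacement (R : ℝ) : Prop :=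
  ∀ Λ : AddSubgroup K, closedBall (0 : K) 1 ⊆ (Λ : Set K) → (Λ : Set K) ⊆ closedBall (0 : K) R →
    ∀ φ : K ≃ₗ[ℚ_[p]] K, φ ∈ Literature.IUT.LogVolume.latticeAut ℚ_[p] Λ.toIntSubmodule →
      ∀ r : ℝ, (φ : K → K) '' closedBall (0 : K) r ⊆ closedBall (0 : K) (p * R * r)

/-- **ROW A3 — [EssLgc] §3.5 (CnfInd1+2), p. 101 (Mochizuki): «at least in the case of q-parameters of sufficiently small valuation
… such a "confusion" [between q-parameters and large positive powers of these q-parameters] can never occur as a consequence of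
(Ind1), (Ind2), i.e., both of which amount to automorphisms of the … log-shells».** CONCRETE typing (the depth condition made
explicit): for `j ≥ 2`, once `‖q‖^{j²−1}·(p·R) < 1`, no lattice automorphism carries the ball of radius `‖q‖^{j²}` (region of `q^{j²}`) ONTO the
ball of radius `‖q‖` (region of `q`). At the frozen interface this is the Repair catalogue's kernel theorem
`Summit.ABC.IUTFork.Repair.CandExplicit8.not_S_of_H_of_deep` (hypothesis `H t`); here `H t` would be DISCHARGED by A1/A2. -/
def LatticeAutCannotConfusePowers (R : ℝ) : Prop :=
  ∀ Λ : AddSubgroup K, closedBall (0 : K) 1 ⊆ (Λ : Set K) → (Λ : Set K) ⊆ closedBall (0 : K) R →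
    ∀ φ : K ≃ₗ[ℚ_[p]] K, φ ∈ Literature.IUT.LogVolume.latticeAut ℚ_[p] Λ.toIntSubmodule →
      ∀ q : K, 0 < ‖q‖ → ∀ j : ℕ, 2 ≤ j → ‖q‖ ^ (j ^ 2 - 1) * (p * R) < 1 →
        (φ : K → K) '' closedBall (0 : K) (‖q‖ ^ (j ^ 2)) ≠ closedBall (0 : K) ‖q‖

/-- The sandwich forces `1 ≤ R` (`1 ∈ closedBall 0 1 ⊆ Λ ⊆ closedBall 0 R`). -/
theorem one_le_of_sandwich {R : ℝ} {Λ : AddSubgroup K} (h1 : closedBall (0 : K) 1 ⊆ (Λ : Set K))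
    (hR : (Λ : Set K) ⊆ closedBall (0 : K) R) : 1 ≤ R := by
  have h1mem : (1 : K) ∈ closedBall (0 : K) 1 := by simp
  have := hR (h1 h1mem)
  rwa [mem_closedBall, dist_zero_right, norm_one] at this

/-- **A1 is an elementary THEOREM at the tree's p-adic model** (rescale by `p^k`, `k = clog_p ‖x‖`). So [EssLgc] Ex. 3.5.1 (iii)
holds for the cell's (Ind2) shape `latticeAut` with the explicit, `ℓ`-independent constant `p·R`. [folklore; cite: Mochizuki2024EssLgc Ex. 3.5.1] -/
theorem latticeAutBoundedDiscrepancy_holds (R : ℝ) : LatticeAutBoundedDiscrepancy p K R := by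
  intro Λ h1 hR φ hφ x
  have hp1 : 1 < p := (Fact.out : p.Prime).one_lt
  have hpR : (0 : ℝ) < p := by exact_mod_cast (Fact.out : p.Prime).pos
  have hR1 : (1 : ℝ) ≤ R := one_le_of_sandwich K h1 hR
  by_cases hx : x = 0
  · subst hx; simp
  have hxpos : 0 < ‖x‖ := norm_pos_iff.mpr hx
  set k : ℤ := Int.clog p ‖x‖ with hk
  have hxle : ‖x‖ ≤ (p : ℝ) ^ k := Int.self_le_zpow_clog hp1 ‖x‖
  have hxgt : (p : ℝ) ^ (k - 1) < ‖x‖ := Int.zpow_pred_clog_lt_self hp1 hxpos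
  have hnormc : ‖((p : ℚ_[p]) ^ k)‖ = (p : ℝ) ^ (-k) := Padic.norm_p_zpow k
  have hy : ‖((p : ℚ_[p]) ^ k) • x‖ ≤ 1 := by
    rw [norm_smul, hnormc, zpow_neg, inv_mul_le_iff₀ (zpow_pos hpR k), mul_one]
    exact hxle
  have hyΛ : ((p : ℚ_[p]) ^ k) • x ∈ Λ.toIntSubmodule := by
    have hmem : ((p : ℚ_[p]) ^ k) • x ∈ (Λ : Set K) := h1 (by rwa [mem_closedBall, dist_zero_right])
    exact hmem
  have hφy : φ (((p : ℚ_[p]) ^ k) • x) ∈ Λ.toIntSubmodule :=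
    ((Literature.IUT.LogVolume.mem_latticeAut_iff φ).mp hφ _).mpr hyΛ
  have hφy' : ‖φ (((p : ℚ_[p]) ^ k) • x)‖ ≤ R := by
    have hmem : φ (((p : ℚ_[p]) ^ k) • x) ∈ closedBall (0 : K) R := hR hφy
    rwa [mem_closedBall, dist_zero_right] at hmem
  rw [map_smul, norm_smul, hnormc, zpow_neg, inv_mul_le_iff₀ (zpow_pos hpR k)] at hφy'
  have hpk : (p : ℝ) ^ k = (p : ℝ) ^ (k - 1) * p := by
    conv_lhs => rw [← sub_add_cancel k 1]
    rw [zpow_add_one₀ hpR.ne']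
  rw [hpk] at hφy'
  have hpRnn : 0 ≤ (p : ℝ) * R := by positivity
  calc ‖φ x‖ ≤ (p : ℝ) ^ (k - 1) * p * R := hφy'
    _ = (p : ℝ) ^ (k - 1) * (p * R) := by ring
    _ ≤ ‖x‖ * (p * R) := mul_le_mul_of_nonneg_right hxgt.le hpRnn
    _ = p * R * ‖x‖ := by ring

/-- A2 from A1. -/
theorem latticeAutShellDisplacement_holds (R : ℝ) : LatticeAutShellDisplacement p K R := by
  intro Λ h1 hR φ hφ r y hy
  obtain ⟨x, hx, rfl⟩ := hy
  have hb := latticeAutBoundedDiscrepancy_holds p K R Λ h1 hR φ hφ x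
  rw [mem_closedBall, dist_zero_right] at hx ⊢
  have hpRnn : 0 ≤ (p : ℝ) * R := by
    have := one_le_of_sandwich K h1 hR
    positivity
  calc ‖φ x‖ ≤ p * R * ‖x‖ := hb
    _ ≤ p * R * r := mul_le_mul_of_nonneg_left hx hpRnn

/-- A2 ⟹ A3 (elementary; recorded to show A3 is the depth corollary of the displacement bound, as (CnfInd1+2) says). -/
theorem latticeAutCannotConfusePowers_of_shellDisplacement {R : ℝ}
    (h : LatticeAutShellDisplacement p K R) : LatticeAutCannotConfusePowers p K R := by
  intro Λ h1 hR φ hφ q hq j hj hdepth heq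
  have hsub := h Λ h1 hR φ hφ (‖q‖ ^ (j ^ 2))
  rw [heq] at hsub
  have hqmem : q ∈ closedBall (0 : K) ‖q‖ := by simp
  have hle := hsub hqmem
  rw [mem_closedBall, dist_zero_right] at hle
  -- ‖q‖ ≤ p·R·‖q‖^{j²} = (‖q‖^{j²-1}·(p·R))·‖q‖ < ‖q‖ : contradiction
  have hpos : 1 ≤ j ^ 2 := Nat.one_le_pow _ _ (by omega)
  have hj' : ‖q‖ ^ (j ^ 2) = ‖q‖ ^ (j ^ 2 - 1) * ‖q‖ := by
    rw [← pow_succ, Nat.sub_add_cancel hpos]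
  rw [hj'] at hle
  have : (p : ℝ) * R * (‖q‖ ^ (j ^ 2 - 1) * ‖q‖) = (‖q‖ ^ (j ^ 2 - 1) * (p * R)) * ‖q‖ := by ring
  rw [this] at hle
  have hlt : (‖q‖ ^ (j ^ 2 - 1) * (p * R)) * ‖q‖ < 1 * ‖q‖ := mul_lt_mul_of_pos_right hdepth hq
  rw [one_mul] at hlt
  exact absurd hle (not_le.mpr hlt)

/-- Hence A3 holds outright at the p-adic model: (Ind2)-type lattice automorphisms cannot confuse `q` with `q^{j²}` past the
explicit depth `‖q‖^{j²−1}·p·R < 1` — [EssLgc] (CnfInd1+2) as a THEOREM of the tree's objects (no side on where the confusion DOES come from). -/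
theorem latticeAutCannotConfusePowers_holds (R : ℝ) : LatticeAutCannotConfusePowers p K R :=
  latticeAutCannotConfusePowers_of_shellDisplacement p K (latticeAutShellDisplacement_holds p K R)

end LatticeAut

section NoRng

/-- **ROW B1 — [EssLgc] §3.4 (NoRng), p. 98 + Example 3.2.2 (i-a), p. 82 + §3.1 (RC-Θ) «false», p. 71 (Mochizuki): «the ring
structures on either side of the Θ-link do NOT admit an isomorphism †R ⥲ ‡R that induces [on value groups] {q^{j²}} ↦ q»; «Θ_k does
not arise from a ring homomorphism».** LOCAL typing over any normed field: no norm-preserving ring automorphism sends `q^{j²}` to a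
unit multiple of `q` (`j ≥ 2`, `0 < ‖q‖ < 1`). «Distinct arithmetic holomorphic structures» in its checkable local form. In-tree
twins: global-degree form `Summit.ABC.IUTFork.ForkPilots.degLgp_thetaPilot_ne_deg_qPilot`; log-link form
`Literature.IUT.LogThetaLattice.NotFromRingHom`. -/
def NoIsometricRingIsoThetaCompatible (K : Type*) [NormedField K] : Prop :=
  ∀ q : K, 0 < ‖q‖ → ‖q‖ < 1 → ∀ j : ℕ, 2 ≤ j →
    ¬ ∃ σ : K ≃+* K, (∀ x, ‖σ x‖ = ‖x‖) ∧ ∃ u : K, ‖u‖ = 1 ∧ σ (q ^ (j ^ 2)) = q * u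

/-- B1 is elementary (sanity proof: `‖q‖^{j²} = ‖q‖` contradicts `0 < ‖q‖ < 1`, `j² ≥ 4`). -/
theorem noIsometricRingIsoThetaCompatible_holds (K : Type*) [NormedField K] :
    NoIsometricRingIsoThetaCompatible K := by
  intro q hq0 hq1 j hj ⟨σ, hσ, u, hu, h⟩
  have hn : ‖σ (q ^ (j ^ 2))‖ = ‖q * u‖ := by rw [h]
  rw [hσ, norm_pow, norm_mul, hu, mul_one] at hn
  have hj2 : 2 ≤ j ^ 2 := le_trans hj (by simpa [sq] using Nat.le_mul_self j)
  have hlt : ‖q‖ ^ (j ^ 2) < ‖q‖ := by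
    calc ‖q‖ ^ (j ^ 2) ≤ ‖q‖ ^ 2 := pow_le_pow_of_le_one hq0.le hq1.le hj2
      _ = ‖q‖ * ‖q‖ := sq ‖q‖
      _ < 1 * ‖q‖ := mul_lt_mul_of_pos_right hq1 hq0
      _ = ‖q‖ := one_mul _
  exact absurd hn (ne_of_lt hlt)

end NoRng

section HeightSchema

/-- **ROW C1 — Formalization slides 2026-04 p. 7 / p. 11 and [EssLgc] §3.11 (Di/NDi) p. 162 (Mochizuki): «the height of the elliptic
curve is, up to a mild discrepancy, unaffected by multiplication by N ⟹ bounded» / «height bound in the style of isogeny invariance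
of heights».** The arithmetic SCHEMA only: `N·h ≤ h + C ⟹ h ≤ C/(N−1)`. Its instance over the campaign's numbers is the in-tree
squeeze `Literature.IUT.LogVolume.ThetaVolumeInput.gap_le_of_cor312Of_of_hullEstimateOf`; the (Di/NDi) sentence itself is typed
as a hypothesis in `Summit.ABC.IUTFork.Repair.CandExplicit30` / `CandExplicit30Height`. The schema supplies NO rigidity by itself. -/
def HeightSchema : Prop :=
  ∀ h C N : ℝ, 1 < N → N * h ≤ h + C → h ≤ C / (N - 1)

theorem heightSchema_holds : HeightSchema := by
  intro h C N hN hle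
  rw [le_div_iff₀ (by linarith)]
  linarith

end HeightSchema

end Summit.ABC.ABC.Cruxes.ThetaPartII.MJHarvest2

end
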